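/-
Copyright (c) 2026 the pub-hodgecm-mathlib formalisation cell (harness21).  Prover seat hodgecm-mathlib-K2E3-p05 (g3), Track B «K2-LIT», engine E3, unit U4 «Keys»,
2026-09-04.  KERNEL module: THEOREMS ONLY (no definition, no named fact, no `sorry`, no instance, no notation).
-/
import Summits.HodgeConjecture.HodgeConjecture.Theorems.K2E3SphericalCFunctionShellExpansion   -- ★ p855911 (K2E3-p04): `apply_eq_apply_uniformizer_zpow`; brings ★ `exists_uniformizer_zpow_mul`, ★ TorusCompactPart `mem_unitsIntegers_iff`
import Literature.NumberTheory.Rogawski1990.SemilocalQuadraticCharExtension                    -- ★ `exists_units_map_toLocalRing_eq_of_conjLocal_eq`; brings ★ `exists_mul_conjLocal_eq_toLocalRing_iff`, ★ `IsQuadraticCharExtension`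
import Literature.NumberTheory.QuadraticForms.HilbertSymbolAtUnramifiedPlace                    -- ★ `hilbertSymbol_eq_one_of_valued_eq_one_of_isUnramifiedIn` (units are norms at an unramified place)
import Literature.NumberTheory.QuadraticForms.QuadraticNormIndex                                -- ★ `hilbertSymbol_eq_one_iff_mem_quadraticNormSubgroup`
import Literature.NumberTheory.Automorphic.QuadraticHeckeCharacterCM                            -- ★ `cmQuadraticGenerator_spec`, `not_isSquare_cmQuadraticGenerator`, ★ `algebraMap_ne_of_complexConj_eq_neg`
import Literature.NumberTheory.Automorphic.NonsplitPlaceHaarBallRatios                          -- ★ `isUnit_toLocalRing_uniformizer`, `conjLocal_toLocalRing_uniformizer`, `valued_toLocalRing_uniformizer_apply` (the `σ`-fixed uniformiser `ι_v ϖ_v`)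
import HarnessLib

/-!
# K2 ∕ E3 «EllipticInputs», unit U4 «Keys» — Road II, II-4 brick «THE UNRAMIFIED SIGN CHARACTER IS `ω_{E∕F}` ON `F^×`»: at an INERT place, an unramified character `η` of `E_vˣ` with
# `η(ϖ) = −1` satisfies `η|_{F_v^×} = ω_{E_v∕F_v}` (★ `IsQuadraticCharExtension`) — the `η` of Keys' point (c) `λ_s = η|·|_E^{1∕2}` [Keys1984 §7 Thm (2)(c); Rogawski1990 §12.2 (2); Serre1979 V §2]

Cell hodgecm-mathlib (D-0151), FLOOR 0, Track B «K2-LIT», engine E3, crux item H413 = stmt-HodgeConjecture-24833 (route `HCCMUnconditional`, no route verbs); target BY NAME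
`…K2E3EllipticInputs.U4Keys.sig_K2E3KeysThmTwoContracting` (U4-f), unramified first rung (Road II of MEMO `K2/K2E3-p05/g2/MEMO-hK-KeysThmTwo-v3`, step 5 case (4): the
«unit-norm lemma»).  Author K2E3-p05 (g3).  `--supports stmt-HodgeConjecture-24833 --as helper`; THEOREMS ONLY.

THE MATHEMATICS.  `v` non-split and unramified in `L∕L⁺`, `E_v = L ⊗ L⁺_v = Π_{w∣v} L_w` (one factor), `σ = c ⊗ 1`.  The second disjunct of U4-f asks for `IsQuadraticCharExtension σ η`:
for every `σ`-FIXED unit `x` of `E_v`, `η x = 1 ↔ x = σ(y)·y` is a norm.  Let `ϖ = ι_v(ϖ_v)` be the `σ`-fixed uniformiser unit of `E_v` (★ `conjLocal_toLocalRing_uniformizer`,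
`|ϖ_w|_w = exp(−1)` ★ `valued_toLocalRing_uniformizer_apply` since `v` is unramified).  An unramified `η` (`η = 1` on `𝒪_vˣ`) with `η = −1` at SOME uniformiser unit has `η(ϖ) = −1`
(★ `apply_eq_apply_uniformizer_zpow`), and every unit is `x = ϖⁿ u`, `u ∈ 𝒪_vˣ` (★ `exists_uniformizer_zpow_mul`), so `η x = (−1)ⁿ`.  (←) If `x = σ(y) y` with `y = ϖ^m u′` then
`|x_w| = |σ(y)_w|·|y_w| = |y_w|²` (★ `valued_conjLocal_apply_of_smul_eq`), so `n = 2m` and `η x = 1`.  (→) If `n = 2k`, then `u = ϖ^{−2k} x` is a `σ`-fixed unit of valuation `0`, hence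
`u = ι_v t` with `t ∈ 𝒪_{L⁺_v}^×` (★ `exists_units_map_toLocalRing_eq_of_conjLocal_eq`, ★ `valued_toPlace_of_isUnramifiedIn`); UNITS ARE NORMS AT AN UNRAMIFIED PLACE: `(t, θ)_v = 1`
(★ `hilbertSymbol_eq_one_of_valued_eq_one_of_isUnramifiedIn`, `L = L⁺(√θ)` ★ `cmQuadraticGenerator_spec`), i.e. `t` is a norm from `L⁺_v(√θ)` (★ `hilbertSymbol_eq_one_iff_mem_quadraticNormSubgroup`),
i.e. `ι_v t = z σ(z)` (★ `exists_mul_conjLocal_eq_toLocalRing_iff`); then `y = ϖ^k z` has `σ(y) y = ϖ^{2k} z σ(z) = x`.  So `η|_{F_v^×} = ω_{E_v∕F_v}`, the unramified quadratic character.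
HONEST LABEL: HC_CM is proved only modulo the 7 printed citations (2 remaining named inputs: hLiu418 = stmt-HodgeConjecture-24832, h413 = stmt-HodgeConjecture-24833)
until rung 0 closes; count-neutral (a brick of the first rung of the row-#5 residue; no printed citation is discharged).

## References
* [Keys1984] D. Keys, Compositio Math. 51 (1984), §7 Theorem (2) (c) p. 126 (`λ|F^× = ω_{E∕F}`, `s = 1∕2`).  * [Rogawski1990] J. D. Rogawski, Ann. of Math. Stud. 123 (1990), §12.2 (2) p. 173, §4.8 p. 51.
* [Serre1979] J.-P. Serre, *Local Fields* (1979), Ch. V §2 Prop. 3 (`N(U_E) = U_F` for unramified `E∕F`).  * [Omeara1963] O. T. O'Meara, *Introduction to Quadratic Forms* (1963), §63C Example 63:16.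
-/

set_option autoImplicit false
-- the mandated namespace has the single-problem summit's repeated segment (`HodgeConjecture.HodgeConjecture`)
set_option linter.dupNamespace false

noncomputable section

open NumberField IsDedekindDomain
open scoped NNReal WithZero
open Literature.NumberTheory Literature.NumberTheory.Automorphic Literature.NumberTheory.Automorphic.UnitaryGroup
open Literature.NumberTheory.Rogawski1990 Literature.NumberTheory.GaloisRepresentations Literature.NumberTheory.QuadraticForms

namespace Summit.HodgeConjecture.HodgeConjecture.Cruxes.H413.K2E3UnramifiedSignCharQuadratic

open Summit.HodgeConjecture.HodgeConjecture.Cruxes.H413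

variable (L : Type) [Field L] [NumberField L] [IsCMField L] (v : HeightOneSpectrum (𝓞 ↥(maximalRealSubfield L)))

/-! ## §1 The `σ`-fixed uniformiser unit `ϖ = ι_v(ϖ_v)` of `E_v` and the decomposition `x = ϖⁿ u` -/

/-- **A `σ`-fixed unit `u ∈ 𝒪_vˣ` is a NORM at a place unramified in `L∕L⁺`**: `u = σ(z)·z` for a unit `z` of `E_v` (`u = ι_v t` with `|t|_v = 1` ★; `(t, θ)_v = 1` ★ units are norms at an
unramified place; ★ the local norm dictionary).  `v` non-split, unramified. [cite: Serre1979, Ch. V §2 Prop. 3] [cite: Omeara1963, §63C Example 63:16] [cite: Rogawski1990, §4.8 p. 51] -/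
theorem exists_conj_mul_self_eq_of_mem_unitsIntegers
    (hunr : Algebra.IsUnramifiedIn (𝓞 L) v.asIdeal) (u : (LocalRing L v)ˣ)
    (hu : u ∈ (Submonoid.pi Set.univ (fun w : PlacesOver L v => (w.1.adicCompletionIntegers L).toSubring.toSubmonoid)).units)
    (hσu : conjLocal L (IsCMField.complexConj L) v (u : LocalRing L v) = u) :
    ∃ z : (LocalRing L v)ˣ, conjLocal L (IsCMField.complexConj L) v (z : LocalRing L v) * z = u := by
  haveI : Algebra.IsQuadraticExtension ↥(maximalRealSubfield L) L := IsCMField.isQuadraticExtension L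
  obtain ⟨w⟩ : Nonempty (PlacesOver L v) := inferInstance
  -- `u = ι_v t`, `|t|_v = 1`
  obtain ⟨t, ht⟩ := exists_units_map_toLocalRing_eq_of_conjLocal_eq v u hσu
  have ht1 : Valued.v (t : v.adicCompletion ↥(maximalRealSubfield L)) = 1 := by
    have h := (F0P3cStCharTSTorusCompactPart.mem_unitsIntegers_iff L v u).1 hu w
    rw [← ht, Units.coe_map, MonoidHom.coe_coe, toLocalRing_apply,
      Liu2021.LemD1IndexedNonVacuityInertCofinite.valued_toPlace_of_isUnramifiedIn L v hunr w] at h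
    exact h
  -- units are norms at an unramified place: `(t, θ)_v = 1`
  obtain ⟨α, hα0, hcα, hsq⟩ := cmQuadraticGenerator_spec L
  have hθ0 : (cmQuadraticGenerator L : ↥(maximalRealSubfield L)) ≠ 0 := by
    exact_mod_cast RingOfIntegers.ne_zero_of_not_isSquare (↥(maximalRealSubfield L)) (not_isSquare_cmQuadraticGenerator L)
  have hθv : algebraMap (↥(maximalRealSubfield L)) (v.adicCompletion ↥(maximalRealSubfield L)) (cmQuadraticGenerator L : ↥(maximalRealSubfield L)) ≠ 0 :=
    (map_ne_zero _).2 hθ0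
  have hsymb := hilbertSymbol_eq_one_of_valued_eq_one_of_isUnramifiedIn (↥(maximalRealSubfield L)) v hsq (NumberFields.algebraMap_ne_of_complexConj_eq_neg hcα hα0) hunr ht1
  haveI : NeZero (2 : v.adicCompletion ↥(maximalRealSubfield L)) := ⟨two_ne_zero⟩
  have hnorm := (hilbertSymbol_eq_one_iff_mem_quadraticNormSubgroup hθv t).1 hsymb
  -- the local norm dictionary: `ι_v t = z · σ z`
  obtain ⟨z, hz⟩ := (exists_mul_conjLocal_eq_toLocalRing_iff v t).2 hnorm
  have hzu : (z * conjLocal L (IsCMField.complexConj L) v z) = (u : LocalRing L v) := by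
    rw [hz, ← ht, Units.coe_map, MonoidHom.coe_coe]
  have hzU : IsUnit z := isUnit_of_mul_isUnit_left (by rw [hzu]; exact u.isUnit)
  refine ⟨hzU.unit, ?_⟩
  rw [hzU.unit_spec, mul_comm, hzu]

/-! ## §2 `η|_{F_v^×} = ω_{E_v∕F_v}` for an unramified `η` with `η(ϖ) = −1` -/

/-- **THE UNRAMIFIED SIGN CHARACTER IS `ω_{E∕F}` ON `F^×`.**  At a non-split place `v` of `L⁺` unramified in `L`, a character `η` of `E_vˣ` trivial on `𝒪_vˣ` with `η(ϖ_E) = −1` for some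
(equivalently every) uniformiser unit `ϖ_E` satisfies ★ `IsQuadraticCharExtension σ η`: on `σ`-fixed units, `η x = 1 ↔ x` is a norm `σ(y) y` — both sides say «`ord(x)` is even»
(§1 for the units, `σ`-fixed uniformiser `ι_v ϖ_v` ★ for the powers; valuations for the converse).  This is the `η` of Keys' point (c) ∕ [Rogawski1990 §12.2 (2)] `χ₁ = η‖·‖^{1∕2}`,
`η|F^× = ω_{E∕F}`, in the unramified case. [cite: Keys1984, §7 Theorem (2) (c) p. 126] [cite: Rogawski1990, §12.2 (2) p. 173; §4.8 p. 51] [cite: Serre1979, Ch. V §2 Prop. 3] -/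
theorem isQuadraticCharExtension_of_unramified_of_apply_uniformizer (hns : ∀ w : PlacesOver L v, IsCMField.complexConj L • w.1 = w.1)
    (hunr : Algebra.IsUnramifiedIn (𝓞 L) v.asIdeal) (η : (LocalRing L v)ˣ →* ℂˣ)
    (hη : ∀ u ∈ (Submonoid.pi Set.univ (fun w : PlacesOver L v => (w.1.adicCompletionIntegers L).toSubring.toSubmonoid)).units, η u = 1)
    (ϖE : (LocalRing L v)ˣ) (hϖE : ∀ w : PlacesOver L v, Valued.v ((ϖE : LocalRing L v) w) = WithZero.exp (-1 : ℤ)) (hηϖ : η ϖE = -1) :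
    IsQuadraticCharExtension (conjLocal L (IsCMField.complexConj L) v) η := by
  intro x hx
  obtain ⟨w⟩ : Nonempty (PlacesOver L v) := inferInstance
  -- the `σ`-fixed uniformiser unit `ϖ = ι_v ϖ_v`
  obtain ⟨ϖ, hϖdef⟩ : ∃ ϖ : (LocalRing L v)ˣ, ϖ = (isUnit_toLocalRing_uniformizer L v).unit := ⟨_, rfl⟩
  have hϖ : ∀ w' : PlacesOver L v, Valued.v ((ϖ : LocalRing L v) w') = WithZero.exp (-1 : ℤ) := fun w' => by
    rw [hϖdef]; exact valued_toLocalRing_uniformizer_apply L v w' hunr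
  have hσϖ : conjLocal L (IsCMField.complexConj L) v (ϖ : LocalRing L v) = ϖ := by rw [hϖdef]; exact conjLocal_toLocalRing_uniformizer L v
  have hηϖ' : η ϖ = -1 := by
    rw [K2E3SphericalCFunctionShellExpansion.apply_eq_apply_uniformizer_zpow L v η hη ϖE hϖE ϖ 1 (fun w' => by rw [hϖ w']), zpow_one, hηϖ]
  -- `x = ϖⁿ u`
  obtain ⟨n, u, hu, hxu, hvx⟩ := K2E3NonUnitaryCharacterDichotomy.exists_uniformizer_zpow_mul L v hns ϖ hϖ x
  have hηx : η x = (-1) ^ n := by rw [hxu, map_mul, map_zpow, hηϖ', hη u hu, mul_one]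
  have hsq1 : ((-1 : ℂˣ)) ^ (2 : ℤ) = 1 := by
    rw [zpow_two]; exact Units.ext (by simp)
  constructor
  · -- (→) `η x = 1`: `n` is even, and `x = σ(y) y` with `y = ϖ^k z`
    intro h1
    rw [hηx] at h1
    obtain ⟨k, hk | hk⟩ := Int.even_or_odd' n
    · -- `u = ϖ^{-2k} x` is `σ`-fixed, hence a norm `σ(z) z` (bookkeeping on units through `σu = Units.map σ`)
      have hσux : Units.map (conjLocal L (IsCMField.complexConj L) v : LocalRing L v →* LocalRing L v) x = x := Units.ext hx
      have hσuϖ : Units.map (conjLocal L (IsCMField.complexConj L) v : LocalRing L v →* LocalRing L v) ϖ = ϖ := Units.ext hσϖ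
      have hσu : conjLocal L (IsCMField.complexConj L) v (u : LocalRing L v) = u := by
        have hu' : u = (ϖ ^ n)⁻¹ * x := by rw [hxu, inv_mul_cancel_left]
        have h := congrArg (fun t : (LocalRing L v)ˣ => (t : LocalRing L v))
          (show Units.map (conjLocal L (IsCMField.complexConj L) v : LocalRing L v →* LocalRing L v) u = u by
            rw [hu', map_mul, map_inv, map_zpow, hσux, hσuϖ])
        rw [Units.coe_map, MonoidHom.coe_coe] at h
        exact h
      obtain ⟨z, hz⟩ := exists_conj_mul_self_eq_of_mem_unitsIntegers L v hunr u hu hσu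
      have hzu : Units.map (conjLocal L (IsCMField.complexConj L) v : LocalRing L v →* LocalRing L v) z * z = u :=
        Units.ext (by rw [Units.val_mul, Units.coe_map, MonoidHom.coe_coe]; exact hz)
      refine ⟨ϖ ^ k * z, ?_⟩
      have key : Units.map (conjLocal L (IsCMField.complexConj L) v : LocalRing L v →* LocalRing L v) (ϖ ^ k * z) * (ϖ ^ k * z) = x := by
        rw [map_mul, map_zpow, hσuϖ, mul_assoc, mul_left_comm (Units.map _ z) (ϖ ^ k) z, ← mul_assoc, ← zpow_add, hzu, hxu, hk, two_mul]
      have h := congrArg (fun t : (LocalRing L v)ˣ => (t : LocalRing L v)) key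
      rw [Units.val_mul, Units.coe_map, MonoidHom.coe_coe] at h
      exact h
    · -- `n` odd: `η x = −1 ≠ 1`
      exfalso
      rw [hk, zpow_add, zpow_one, zpow_mul, hsq1, one_zpow, one_mul] at h1
      exact absurd (congrArg Units.val h1) (by norm_num)
  · -- (←) `x = σ(y) y`: `ord(x) = 2 ord(y)` is even
    rintro ⟨y, hy⟩
    obtain ⟨m, u', -, -, hvy⟩ := K2E3NonUnitaryCharacterDichotomy.exists_uniformizer_zpow_mul L v hns ϖ hϖ y
    have hval := congrArg (fun r : LocalRing L v => Valued.v (r w)) hy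
    simp only [Pi.mul_apply, map_mul] at hval
    rw [valued_conjLocal_apply_of_smul_eq L v w (hns w) (y : LocalRing L v), hvy w, hvx w, ← WithZero.exp_add] at hval
    have hnm : n = 2 * m := by
      have := WithZero.exp_injective hval
      omega
    rw [hηx, hnm, zpow_mul, hsq1, one_zpow]

end Summit.HodgeConjecture.HodgeConjecture.Cruxes.H413.K2E3UnramifiedSignCharQuadratic

end
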